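import Summits.QuantumFields.YangMills.Theorems.FluctuationComparisonRegPrIntLS2BetaOneStepMeanLetter
import HarnessLib

/-!
# hFlat road (γ): REORDER-LOOP STOKES — swapping two adjacent runs of a staircase costs ONE rectangle; the (0.4) reorder loop along any chain of swaps
# (§C of the one-step mean letter ✓`…S2BetaOneStepMeanLetter`; crux `FluctuationComparisonRegPrIntL`, stmt-QuantumFields-20520)

Cell `ym3-torus` (YM ladder rung R3 = continuum `SU(2)` Yang–Mills on the three-torus — a RUNG: NOT d = 4, NOT infinite volume, NOT a mass gap, NOT Clay).
Width seat `ym3-torus-px13` (gen 22); the residual letter §C of (b3) (px12 g22 06:20:47Z (3); px21 g21 took (iii-b) instead, 06:45Z).  `--kind proof --supports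
stmt-QuantumFields-20520 --as helper`, count-neutral, DEFINITION-FREE (0 `def`, 0 `instance`, 0 `notation`, 0 `sorry`, default heartbeats).  Pure lattice kinematics
for ANY gauge group on ANY torus of the tree's `Params`.

WHY.  ✓(b3) `dist1_loopHol_le_diag_add_reorder` reduces every (0.4) loop variable `W_{r,σ,σ′}` to the DIAGONAL one (bounded by rectangle legs) plus the REORDER LOOP
`U(Γ^σ_{c₊}) · U(Γ^{σ′}_{c₊})⁻¹` — two staircases with the same endpoints and different run orders.  Ordering `σ′` into `σ` by adjacent transpositions of RUNS changes
the staircase holonomy, at each step, by exactly ONE rectangle (the two swapped runs span it); the prefix conjugates away and the suffix cancels.  This is the `ℓ¹`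
(explicit-surface) Stokes the π′-count of HOME `ym3-torus-px12/g22/HFLAT-ROAD-AFTER-6` §3 needs — not the sup form of lit ✓`LatticeWordStokes` (whose letter-swap
calculus `holAt_walk_swap_eq` is the one-letter case of §3 here).

WHAT.
* §1 ★ `dist1_chain_le` — the group telescope `dist1 (h₀ h_m⁻¹) ≤ Σ_{i<m} dist1 (h_i h_{i+1}⁻¹)`.
* §2 `stairRuns_append` (staircase words over concatenated axis lists).
* §3 ★★ `dist1_twoRun_comm (U z a b k l) : dist1 (U(a^k b^l ▸ z) · U(b^l a^k ▸ z)⁻¹) = dist1 (rect U (z − k⁻e_a − l⁻e_b) a b |k| |l|)` — the two-run commutator IS one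
  rectangle at the lower corner (four sign cases, each a conjugate of `rect^{±1}`; corners via ✓(b3) §1 `holAt_walk_axisRun_of_nonneg∕_of_neg`).
* §4 ★★ `dist1_stairRuns_swap_eq (U y n A a b C)` — ADJACENT-RUN SWAP STOKES: `dist1 (U(Γ_{A a b C}) · U(Γ_{A b a C})⁻¹) = dist1 U(∂R)`, `R` the `|n a| × |n b|`
  rectangle in the `(a,b)`-plane at `walkEnd y (stairRuns n A) − (n a)⁻e_a − (n b)⁻e_b` (EXPLICIT corner).
* §5 ★★ `dist1_reorder_le_chain` — the reorder loop `U(Γ^σ ∪ (−Γ^{σ′}))` of ✓(b3) along ANY chain of axis lists from `(finRange d).map σ` to `(finRange d).map σ′`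
  is bounded by the sum of the consecutive comparisons; with §4 at each adjacent swap: `≤` one explicit rectangle per swap (`≤ d(d−1)∕2` of them by bubble sort), then
  plaquettes ∕ squares by ✓(7) `dist1_rect_sq_le`.

HONEST: kinematics (subadditivity ∕ conjugation invariance of `dist1`, list bookkeeping); the choice of the sorting chain is the consumer's; nothing of Bałaban's analysis;
hFlat, TUBE-REG∘, GAP♯∘, EXW∘, S2β, crux 20520 NOT proved; no registered stub closed; rung R3 = SU(2) YM₃ on T³ — NOT d = 4, NOT infinite volume, NOT a mass gap, NOT Clay;
the Yang–Mills mass gap is NOT proved.  Sorry-free, axioms standard.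

References: T. Bałaban, CMP **109** (1987) 249–301 [Balaban1987RG1] ((0.3)–(0.4) pp.252–253); CMP **98** (1985) 17–51 [Balaban1985Averaging] ((9) p.19, (19)–(20) p.21);
CMP **99** (1985) 75–102 [Balaban1985RegularSpaces] (Lemma 1 p.79).
-/

set_option autoImplicit false

noncomputable section

namespace Summit.QuantumFields.YangMills.Theorems.FluctuationComparisonRegPrIntLS2BetaReorderLoopStokes

open Finset
open Literature.MathematicalPhysics.QuantumFieldTheory.Balaban1983to89
open T4Continuum
open B10Eq47AxialChi (shiftN shiftN_zero shiftN_succ rowProd rowProd_zero rowProd_succ rect)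
open BlockAveragingEMLProp2 (walkEnd_replicate_true holAt_walk_replicate_true)
open Summit.QuantumFields.YangMills.Theorems.FluctuationComparisonRegPrIntLS2BetaRowTransportVariance (shiftN_comm shiftN_add rect_swap)
open Summit.QuantumFields.YangMills.Theorems.FluctuationComparisonRegPrIntLS2BetaOneStepMeanLetter
  (holAt_walk_axisRun_of_nonneg holAt_walk_axisRun_of_neg walkEnd_shiftN reorder_eq_holAt_append)

variable {P : Params} {j : ℕ} {G : Type*} [GaugeGroup G]

/-! ## §1 The group telescope along a chain of words -/

/-- **CHAIN TELESCOPE** (any group elements `h₀, …, h_m`): `dist1 (h₀ · h_m⁻¹) ≤ Σ_{i<m} dist1 (h_i · h_{i+1}⁻¹)` — `h₀h_m⁻¹ = Π_i (h_i h_{i+1}⁻¹)` and subadditivity.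
[cite: Balaban1985Averaging, (19)-(20) p.21] -/
theorem dist1_chain_le (h : ℕ → G) : ∀ m : ℕ, dist1 (h 0 * (h m)⁻¹) ≤ ∑ i ∈ range m, dist1 (h i * (h (i + 1))⁻¹)
  | 0 => by simp [GaugeGroup.dist1_one]
  | m + 1 => by
    rw [Finset.sum_range_succ]
    have e : h 0 * (h (m + 1))⁻¹ = (h 0 * (h m)⁻¹) * (h m * (h (m + 1))⁻¹) := by group
    rw [e]
    exact (GaugeGroup.dist1_mul_le _ _).trans (add_le_add (dist1_chain_le h m) le_rfl)

/-! ## §2 Staircase runs over concatenated axis lists -/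

/-- `stairRuns` is a monoid morphism from axis lists to words. [cite: Balaban1987RG1, (0.3) p.252] -/
theorem stairRuns_append (n : Fin P.d → ℤ) : ∀ (l₁ l₂ : List (Fin P.d)), stairRuns n (l₁ ++ l₂) = stairRuns n l₁ ++ stairRuns n l₂
  | [], l₂ => rfl
  | a :: l₁, l₂ => by
    show axisRun a (n a) ++ stairRuns n (l₁ ++ l₂) = (axisRun a (n a) ++ stairRuns n l₁) ++ stairRuns n l₂
    rw [stairRuns_append n l₁ l₂, List.append_assoc]

/-! ## §3 Swapping two adjacent runs costs ONE rectangle -/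

/-- The two-run commutator loop at `z`: `U(a^k b^l) · U(b^l a^k)⁻¹` (both words from `z`), its `dist1` is that of the `|k| × |l|` rectangle in the `(a, b)`-plane at the LOWER corner
`z − k⁻ e_a − l⁻ e_b` (`k⁻ = max(−k, 0)`): four sign cases, each a conjugate of `rect^{±1}`. [cite: Balaban1985Averaging, (9) p.19, (19)-(20) p.21] -/
theorem dist1_twoRun_comm (U : GaugeField P j G) (z : Site P j) (a b : Fin P.d) (k l : ℤ) :
    dist1 (holAt U (walk z (axisRun a k ++ axisRun b l)) * (holAt U (walk z (axisRun b l ++ axisRun a k)))⁻¹) =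
      dist1 (rect U (walkEnd (walkEnd z (axisRun a (min k 0))) (axisRun b (min l 0))) a b k.natAbs l.natAbs) := by
  rw [walk_append, holAt_append, walk_append, holAt_append]
  rcases le_or_gt 0 k with hk | hk <;> rcases le_or_gt 0 l with hl | hl
  · -- k ≥ 0, l ≥ 0: the loop IS the rectangle at z
    obtain ⟨ha1, ha2⟩ := holAt_walk_axisRun_of_nonneg U z a hk
    obtain ⟨hb1, hb2⟩ := holAt_walk_axisRun_of_nonneg U z b hl
    obtain ⟨hab1, -⟩ := holAt_walk_axisRun_of_nonneg U (walkEnd z (axisRun a k)) b hl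
    obtain ⟨hba1, -⟩ := holAt_walk_axisRun_of_nonneg U (walkEnd z (axisRun b l)) a hk
    rw [ha1, hb1, hab1, hba1, ha2, hb2, min_eq_right hk, min_eq_right hl]
    have h0a : axisRun a (0 : ℤ) = ([] : List (Letter P.d)) := by simp [axisRun]
    have h0b : axisRun b (0 : ℤ) = ([] : List (Letter P.d)) := by simp [axisRun]
    rw [h0a, h0b]
    show dist1 (rowProd U z a k.natAbs * rowProd U (shiftN z a k.natAbs) b l.natAbs *
        (rowProd U z b l.natAbs * rowProd U (shiftN z b l.natAbs) a k.natAbs)⁻¹) = dist1 (rect U z a b k.natAbs l.natAbs)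
    have e : rowProd U z a k.natAbs * rowProd U (shiftN z a k.natAbs) b l.natAbs *
        (rowProd U z b l.natAbs * rowProd U (shiftN z b l.natAbs) a k.natAbs)⁻¹ = rect U z a b k.natAbs l.natAbs := by
      unfold rect; group
    rw [e]
  · -- k ≥ 0, l < 0: corner z − |l| e_b
    obtain ⟨ha1, ha2⟩ := holAt_walk_axisRun_of_nonneg U z a hk
    obtain ⟨hb1, hb2⟩ := holAt_walk_axisRun_of_neg U z b hl
    set z₁ := walkEnd z (axisRun b l) with hz₁
    obtain ⟨hab1, hab2⟩ := holAt_walk_axisRun_of_neg U (walkEnd z (axisRun a k)) b hl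
    obtain ⟨hba1, hba2⟩ := holAt_walk_axisRun_of_nonneg U z₁ a hk
    rw [min_eq_right hk, min_eq_left hl.le]
    have h0a : axisRun a (0 : ℤ) = ([] : List (Letter P.d)) := by simp [axisRun]
    rw [h0a]
    show dist1 (holAt U (walk z (axisRun a k)) * holAt U (walk (walkEnd z (axisRun a k)) (axisRun b l)) *
        (holAt U (walk z (axisRun b l)) * holAt U (walk z₁ (axisRun a k)))⁻¹) =
      dist1 (rect U z₁ a b k.natAbs l.natAbs)
    -- corner bookkeeping: the end of `a^k b^l` from `z` is `z₁ + |k| e_a`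
    have hc : walkEnd (walkEnd z (axisRun a k)) (axisRun b l) = shiftN z₁ a k.natAbs := by
      rw [← hba2]
      funext κ
      simp only [hz₁, walkEnd_apply]
      ring
    have hz : shiftN z₁ b l.natAbs = z := hb1
    rw [ha1, hab2, hc, hb2, hba1]
    have e : rowProd U z a k.natAbs * (rowProd U (shiftN z₁ a k.natAbs) b l.natAbs)⁻¹ *
        ((rowProd U z₁ b l.natAbs)⁻¹ * rowProd U z₁ a k.natAbs)⁻¹ =
      (rowProd U z₁ b l.natAbs)⁻¹ * (rect U z₁ a b k.natAbs l.natAbs)⁻¹ * ((rowProd U z₁ b l.natAbs)⁻¹)⁻¹ := by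
      unfold rect; rw [hz]; group
    rw [e, GaugeGroup.dist1_conj, GaugeGroup.dist1_inv]
  · -- k < 0, l ≥ 0: corner z₁ = z − |k| e_a
    obtain ⟨ha1, ha2⟩ := holAt_walk_axisRun_of_neg U z a hk
    obtain ⟨hb1, hb2⟩ := holAt_walk_axisRun_of_nonneg U z b hl
    set z₁ := walkEnd z (axisRun a k) with hz₁
    obtain ⟨hab1, hab2⟩ := holAt_walk_axisRun_of_nonneg U z₁ b hl
    obtain ⟨hba1, hba2⟩ := holAt_walk_axisRun_of_neg U (walkEnd z (axisRun b l)) a hk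
    rw [min_eq_left hk.le, min_eq_right hl]
    have h0b : axisRun b (0 : ℤ) = ([] : List (Letter P.d)) := by simp [axisRun]
    rw [h0b]
    show dist1 (holAt U (walk z (axisRun a k)) * holAt U (walk z₁ (axisRun b l)) *
        (holAt U (walk z (axisRun b l)) * holAt U (walk (walkEnd z (axisRun b l)) (axisRun a k)))⁻¹) =
      dist1 (rect U z₁ a b k.natAbs l.natAbs)
    -- corner bookkeeping: the end of `b^l a^k` from `z` is `z₁ + l e_b`
    have hc : walkEnd (walkEnd z (axisRun b l)) (axisRun a k) = shiftN z₁ b l.natAbs := by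
      rw [← hab2]
      funext κ
      simp only [hz₁, walkEnd_apply]
      ring
    have hz : shiftN z₁ a k.natAbs = z := ha1
    rw [ha2, hab1, hb1, hba2, hc]
    have e : (rowProd U z₁ a k.natAbs)⁻¹ * rowProd U z₁ b l.natAbs *
        (rowProd U z b l.natAbs * (rowProd U (shiftN z₁ b l.natAbs) a k.natAbs)⁻¹)⁻¹ =
      (rowProd U z₁ a k.natAbs)⁻¹ * (rect U z₁ a b k.natAbs l.natAbs)⁻¹ * ((rowProd U z₁ a k.natAbs)⁻¹)⁻¹ := by
      unfold rect; rw [hz]; group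
    rw [e, GaugeGroup.dist1_conj, GaugeGroup.dist1_inv]
  · -- k < 0, l < 0: corner z₂ = z − |k| e_a − |l| e_b
    obtain ⟨ha1, ha2⟩ := holAt_walk_axisRun_of_neg U z a hk
    set z₁ := walkEnd z (axisRun a k) with hz₁
    obtain ⟨hab1, hab2⟩ := holAt_walk_axisRun_of_neg U z₁ b hl
    set z₂ := walkEnd z₁ (axisRun b l) with hz₂
    obtain ⟨hb1, hb2⟩ := holAt_walk_axisRun_of_neg U z b hl
    set z₃ := walkEnd z (axisRun b l) with hz₃
    obtain ⟨hba1, hba2⟩ := holAt_walk_axisRun_of_neg U z₃ a hk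
    rw [min_eq_left hk.le, min_eq_left hl.le]
    show dist1 (holAt U (walk z (axisRun a k)) * holAt U (walk z₁ (axisRun b l)) *
        (holAt U (walk z (axisRun b l)) * holAt U (walk z₃ (axisRun a k)))⁻¹) =
      dist1 (rect U z₂ a b k.natAbs l.natAbs)
    -- corner bookkeeping: `z₃ = z₂ + |k| e_a`, and the end of `b^l a^k` from `z` is `z₂`
    have hc : walkEnd z₃ (axisRun a k) = z₂ := by
      funext κ
      simp only [hz₃, hz₂, hz₁, walkEnd_apply]
      ring
    have hz3 : z₃ = shiftN z₂ a k.natAbs := by rw [← hc]; exact hba1.symm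
    have hz1 : z₁ = shiftN z₂ b l.natAbs := hab1.symm
    rw [ha2, hab2, hb2, hba2, hc, hz3, hz1]
    have e : (rowProd U (shiftN z₂ b l.natAbs) a k.natAbs)⁻¹ * (rowProd U z₂ b l.natAbs)⁻¹ *
        ((rowProd U (shiftN z₂ a k.natAbs) b l.natAbs)⁻¹ * (rowProd U z₂ a k.natAbs)⁻¹)⁻¹ =
      ((rowProd U (shiftN z₂ b l.natAbs) a k.natAbs)⁻¹ * (rowProd U z₂ b l.natAbs)⁻¹) * rect U z₂ a b k.natAbs l.natAbs *
        ((rowProd U (shiftN z₂ b l.natAbs) a k.natAbs)⁻¹ * (rowProd U z₂ b l.natAbs)⁻¹)⁻¹ := by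
      unfold rect; group
    rw [e, GaugeGroup.dist1_conj]

/-! ## §4 Swapping two adjacent runs of a staircase costs ONE rectangle -/

/-- ★★ **ADJACENT-RUN SWAP STOKES**: for an axis list `A ++ a :: b :: C` and offsets `n`, swapping the two adjacent runs `a^{n a} b^{n b} ↦ b^{n b} a^{n a}` changes the staircase
holonomy from `y` by exactly one rectangle: `dist1 (U(Γ_{A a b C}) · U(Γ_{A b a C})⁻¹) = dist1 U(∂R)`, `R` the `|n a| × |n b|` rectangle in the `(a, b)`-plane at the lower
corner `walkEnd y (stairRuns n A) − (n a)⁻ e_a − (n b)⁻ e_b`.  (The prefix conjugates, the suffix cancels: both middle words end at the same site.)  Along ANY chain of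
adjacent run swaps `σ = τ₀ → ⋯ → τ_m = σ′` the REORDER LOOP of ✓(b3) §5 is then bounded by `Σ_i` one rectangle per swap (`dist1_chain_le`). [cite: Balaban1987RG1, (0.3) p.252; Balaban1985Averaging, (9) p.19, (19)-(20) p.21] -/
theorem dist1_stairRuns_swap_eq (U : GaugeField P j G) (y : Site P j) (n : Fin P.d → ℤ) (A C : List (Fin P.d)) (a b : Fin P.d) :
    dist1 (holAt U (walk y (stairRuns n (A ++ a :: b :: C))) * (holAt U (walk y (stairRuns n (A ++ b :: a :: C))))⁻¹) =
      dist1 (rect U (walkEnd (walkEnd (walkEnd y (stairRuns n A)) (axisRun a (min (n a) 0))) (axisRun b (min (n b) 0)))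
        a b (n a).natAbs (n b).natAbs) := by
  have h1 : stairRuns n (A ++ a :: b :: C) = stairRuns n A ++ ((axisRun a (n a) ++ axisRun b (n b)) ++ stairRuns n C) := by
    rw [stairRuns_append]
    show stairRuns n A ++ (axisRun a (n a) ++ (axisRun b (n b) ++ stairRuns n C)) = _
    rw [List.append_assoc]
  have h2 : stairRuns n (A ++ b :: a :: C) = stairRuns n A ++ ((axisRun b (n b) ++ axisRun a (n a)) ++ stairRuns n C) := by
    rw [stairRuns_append]
    show stairRuns n A ++ (axisRun b (n b) ++ (axisRun a (n a) ++ stairRuns n C)) = _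
    rw [List.append_assoc]
  set z := walkEnd y (stairRuns n A) with hz
  have hend : walkEnd z (axisRun a (n a) ++ axisRun b (n b)) = walkEnd z (axisRun b (n b) ++ axisRun a (n a)) := by
    funext κ
    rw [walkEnd_apply, walkEnd_apply, T4ReflectionCone.netDisp_append, T4ReflectionCone.netDisp_append, add_comm (netDisp (axisRun a (n a)) κ)]
  have eX : holAt U (walk y (stairRuns n (A ++ a :: b :: C))) =
      holAt U (walk y (stairRuns n A)) * (holAt U (walk z (axisRun a (n a) ++ axisRun b (n b))) *
        holAt U (walk (walkEnd z (axisRun b (n b) ++ axisRun a (n a))) (stairRuns n C))) := by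
    rw [h1, walk_append y (stairRuns n A), holAt_append, ← hz,
      walk_append z (axisRun a (n a) ++ axisRun b (n b)) (stairRuns n C), holAt_append, hend]
  have eY : holAt U (walk y (stairRuns n (A ++ b :: a :: C))) =
      holAt U (walk y (stairRuns n A)) * (holAt U (walk z (axisRun b (n b) ++ axisRun a (n a))) *
        holAt U (walk (walkEnd z (axisRun b (n b) ++ axisRun a (n a))) (stairRuns n C))) := by
    rw [h2, walk_append y (stairRuns n A), holAt_append, ← hz,
      walk_append z (axisRun b (n b) ++ axisRun a (n a)) (stairRuns n C), holAt_append]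
  rw [eX, eY]
  set HA := holAt U (walk y (stairRuns n A))
  set X := holAt U (walk z (axisRun a (n a) ++ axisRun b (n b)))
  set Y := holAt U (walk z (axisRun b (n b) ++ axisRun a (n a)))
  set HC := holAt U (walk (walkEnd z (axisRun b (n b) ++ axisRun a (n a))) (stairRuns n C))
  have e : HA * (X * HC) * (HA * (Y * HC))⁻¹ = HA * (X * Y⁻¹) * HA⁻¹ := by group
  rw [e, GaugeGroup.dist1_conj]
  exact dist1_twoRun_comm U z a b (n a) (n b)

/-! ## §5 The (0.4) REORDER LOOP along a chain of axis lists -/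

/-- ★★ **THE REORDER LOOP OF ✓(b3) §5 ALONG ANY CHAIN**: for axis lists `ls 0, …, ls m` with `ls 0 = (finRange d).map σ` and `ls m = (finRange d).map σ′` (so the end words are
the staircases `Γ^σ`, `Γ^{σ′}` — `stairWord σ n = stairRuns n ((finRange d).map σ)` by definition), the reorder loop satisfies
`dist1 (U(Γ^σ_y) · U(Γ^{σ′}_y)⁻¹) ≤ Σ_{i<m} dist1 (U(stairRuns n (ls i) ▸ y) · U(stairRuns n (ls (i+1)) ▸ y)⁻¹)`; every consecutive pair that is an ADJACENT RUN SWAP is ONE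
explicit rectangle by `dist1_stairRuns_swap_eq` (bubble sort: `≤ d(d−1)∕2` swaps). [cite: Balaban1987RG1, (0.3)-(0.4) pp.252-253; Balaban1985Averaging, (19)-(20) p.21] -/
theorem dist1_reorder_le_chain (U : GaugeField P j G) (y : Site P j) (n : Fin P.d → ℤ) (σ σ' : Equiv.Perm (Fin P.d))
    (ls : ℕ → List (Fin P.d)) (m : ℕ) (h0 : ls 0 = (List.finRange P.d).map σ) (hm : ls m = (List.finRange P.d).map σ') :
    dist1 (holAt U (walk y (stairWord σ n ++ wordRev (stairWord σ' n)))) ≤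
      ∑ i ∈ range m, dist1 (holAt U (walk y (stairRuns n (ls i))) * (holAt U (walk y (stairRuns n (ls (i + 1)))))⁻¹) := by
  rw [← reorder_eq_holAt_append]
  have h := dist1_chain_le (fun i => holAt U (walk y (stairRuns n (ls i)))) m
  simp only [h0, hm] at h
  exact h

end Summit.QuantumFields.YangMills.Theorems.FluctuationComparisonRegPrIntLS2BetaReorderLoopStokes

end
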